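import Summits.Ventures.PercRepro.C041BlockMapPathHost

/-!
# ROW C-041 — THEOREM (PATH): the block map of a host with an edge replaced by a path with `n` internal vertices
is the block map of the host plus `2ⁿ − 1` times the block map of the host with that edge turned into a loop
(p6, gen 35; the general coefficient of mine-3's C-041.md §21 (a), THEOREM (SUBDIVISION) of
`C041BlockMapSubdiv` being the case `n = 1`)

Setting of `C041BlockMapPathHost`: the path host `pathHost Z₁ e₀ n` (exits `inl ∘ u`, anchor `inl a₁`) and the
statuses of its old vertices under an agreeing colouring (`pathAgree`: the new segments all carry the colour of
`e₀` — read off `Z₁`) or a disagreeing one (read off `loopify Z₁ e₀`).  Hence the merged set, the blocks and the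
colouring term of the path host are those of `Z₁` or of `loopify Z₁ e₀` under the restricted colouring `ω' ∘ inl`
(`colTerm_path_agree`, `colTerm_path_disagree`); the colourings of the path host are the pairs (colouring of
`Z₁`, colouring of the `n` new segments), and of the `2ⁿ` colourings of the new segments exactly one agrees with
the colour of `e₀` (`sum_colTerm_path_elim`): **`blockMap_path`: `blockMap (pathHost Z₁ e₀ n) (inl ∘ u) (inl a₁) w
= blockMap Z₁ u a₁ w + (2ⁿ − 1) • blockMap (loopify Z₁ e₀) u a₁ w`**, i.e. `Θ_{path} = Θ_{Z₁} +
(2^{n+1} − 2) • Θ_{Z₁ − e₀}` (`blockMap_path_del`, with `blockMap_loopify`).  COROLLARY: the cone conjecture for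
block maps is closed under replacing an edge by a path of any length (`inCone_blockMap_path`,
`inCone_blockMap_path_del`): with THEOREM (HANG), THEOREM (WEDGE) and the reductions, CONJECTURE (BLOCK MAP) for
every host follows from the hosts whose non-terminal vertices have degree `≥ 3`, with every chain of degree-two
vertices collapsed in one step.
-/

namespace PercRepro

namespace ZoneZ

namespace MultiExit

open ZoneData Pendant Finset TwoExit TreeClosure

variable {V₁ E₁ U₁ U₂ : Type} (Z₁ : ZoneData V₁ E₁ U₁ U₂) (e₀ : E₁) (n : ℕ) [DecidableEq E₁]

/-! ## The merged set, the blocks and the colouring terms -/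

section Terms

variable {ι : Type} (u : ι → V₁) (a₁ : V₁) [Fintype ι] (ω' : E₁ ⊕ Fin n → Bool)

/-- The merged set of the path host, colouring agreeing. -/
theorem merged_path_agree (h : pathAgree e₀ n ω') :
    merged (pathHost Z₁ e₀ n) (fun k => Sum.inl (u k)) (Sum.inl a₁) ω' =
      merged Z₁ u a₁ fun e => ω' (Sum.inl e) := by
  ext k
  rw [mem_merged, mem_merged, Mg_path_agree Z₁ e₀ n ω' h]

/-- The blocks of the path host, colouring agreeing. -/
theorem blk_path_agree (h : pathAgree e₀ n ω') :
    blk (pathHost Z₁ e₀ n) (fun k => Sum.inl (u k)) (Sum.inl a₁) ω' = blk Z₁ u a₁ fun e => ω' (Sum.inl e) := by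
  funext k
  ext l
  rw [mem_blk, mem_blk, Mg_path_agree Z₁ e₀ n ω' h, Mg_path_agree Z₁ e₀ n ω' h]

/-- The blocks of the path host, colouring agreeing. -/
theorem blocks_path_agree (h : pathAgree e₀ n ω') :
    blocks (pathHost Z₁ e₀ n) (fun k => Sum.inl (u k)) (Sum.inl a₁) ω' =
      blocks Z₁ u a₁ fun e => ω' (Sum.inl e) := by
  ext B
  rw [mem_blocks, mem_blocks]
  simp only [Mg_path_agree Z₁ e₀ n ω' h, blk_path_agree Z₁ e₀ n u a₁ ω' h]

/-- The merged set of the path host, colouring disagreeing. -/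
theorem merged_path_disagree (h : ¬ pathAgree e₀ n ω') :
    merged (pathHost Z₁ e₀ n) (fun k => Sum.inl (u k)) (Sum.inl a₁) ω' =
      merged (loopify Z₁ e₀) u a₁ fun e => ω' (Sum.inl e) := by
  ext k
  rw [mem_merged, mem_merged, Mg_path_disagree Z₁ e₀ n ω' h]

/-- The blocks of the path host, colouring disagreeing. -/
theorem blk_path_disagree (h : ¬ pathAgree e₀ n ω') :
    blk (pathHost Z₁ e₀ n) (fun k => Sum.inl (u k)) (Sum.inl a₁) ω' =
      blk (loopify Z₁ e₀) u a₁ fun e => ω' (Sum.inl e) := by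
  funext k
  ext l
  rw [mem_blk, mem_blk, Mg_path_disagree Z₁ e₀ n ω' h, Mg_path_disagree Z₁ e₀ n ω' h]

/-- The blocks of the path host, colouring disagreeing. -/
theorem blocks_path_disagree (h : ¬ pathAgree e₀ n ω') :
    blocks (pathHost Z₁ e₀ n) (fun k => Sum.inl (u k)) (Sum.inl a₁) ω' =
      blocks (loopify Z₁ e₀) u a₁ fun e => ω' (Sum.inl e) := by
  ext B
  rw [mem_blocks, mem_blocks]
  simp only [Mg_path_disagree Z₁ e₀ n ω' h, blk_path_disagree Z₁ e₀ n u a₁ ω' h]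

/-- **The colouring term of the path host, colouring agreeing**, is the colouring term of `Z₁`. -/
theorem colTerm_path_agree (h : pathAgree e₀ n ω') (w : ι → Vec6) :
    colTerm (pathHost Z₁ e₀ n) (fun k => Sum.inl (u k)) (Sum.inl a₁) ω' w =
      colTerm Z₁ u a₁ (fun e => ω' (Sum.inl e)) w := by
  unfold colTerm
  rw [merged_path_agree Z₁ e₀ n u a₁ ω' h, blocks_path_agree Z₁ e₀ n u a₁ ω' h]
  simp only [Rd_path_agree Z₁ e₀ n ω' h]

/-- **The colouring term of the path host, colouring disagreeing**, is the colouring term of the loopified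
host. -/
theorem colTerm_path_disagree (h : ¬ pathAgree e₀ n ω') (w : ι → Vec6) :
    colTerm (pathHost Z₁ e₀ n) (fun k => Sum.inl (u k)) (Sum.inl a₁) ω' w =
      colTerm (loopify Z₁ e₀) u a₁ (fun e => ω' (Sum.inl e)) w := by
  unfold colTerm
  rw [merged_path_disagree Z₁ e₀ n u a₁ ω' h, blocks_path_disagree Z₁ e₀ n u a₁ ω' h]
  simp only [Rd_path_disagree Z₁ e₀ n ω' h]

end Terms

/-! ## THEOREM (PATH) -/

section Main

variable {ι : Type} (u : ι → V₁) (a₁ : V₁) [Fintype ι] [Fintype E₁]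

omit [Fintype E₁] in
/-- The colouring term of the path host at a glued colouring: the term of `Z₁` if the new segments all carry the
colour of `e₀`, the term of the loopified host otherwise. -/
theorem colTerm_path_elim (ω : E₁ → Bool) (τ : Fin n → Bool) (w : ι → Vec6) :
    colTerm (pathHost Z₁ e₀ n) (fun k => Sum.inl (u k)) (Sum.inl a₁) (Sum.elim ω τ) w =
      if τ = fun _ => ω e₀ then colTerm Z₁ u a₁ ω w else colTerm (loopify Z₁ e₀) u a₁ ω w := by
  by_cases hτ : τ = fun _ => ω e₀
  · rw [if_pos hτ, colTerm_path_agree Z₁ e₀ n u a₁ _ ((pathAgree_elim_iff e₀ n ω τ).2 hτ) w]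
    rfl
  · rw [if_neg hτ, colTerm_path_disagree Z₁ e₀ n u a₁ _ (fun h => hτ ((pathAgree_elim_iff e₀ n ω τ).1 h)) w]
    rfl

omit [Fintype E₁] in
/-- Summing the colouring terms over the colourings of the `n` new segments: exactly one of the `2ⁿ` colourings
agrees with the colour of `e₀`. -/
theorem sum_colTerm_path_elim (ω : E₁ → Bool) (w : ι → Vec6) :
    ∑ τ : Fin n → Bool, colTerm (pathHost Z₁ e₀ n) (fun k => Sum.inl (u k)) (Sum.inl a₁) (Sum.elim ω τ) w =
      colTerm Z₁ u a₁ ω w + ((2 : ℝ) ^ n - 1) • colTerm (loopify Z₁ e₀) u a₁ ω w := by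
  have hterm : ∀ τ : Fin n → Bool,
      colTerm (pathHost Z₁ e₀ n) (fun k => Sum.inl (u k)) (Sum.inl a₁) (Sum.elim ω τ) w =
        colTerm (loopify Z₁ e₀) u a₁ ω w +
          if τ = fun _ => ω e₀ then colTerm Z₁ u a₁ ω w - colTerm (loopify Z₁ e₀) u a₁ ω w else 0 := by
    intro τ
    rw [colTerm_path_elim Z₁ e₀ n u a₁ ω τ w]
    split_ifs <;> abel
  rw [Finset.sum_congr rfl fun τ _ => hterm τ, Finset.sum_add_distrib, Finset.sum_const, Finset.sum_ite_eq',
    if_pos (Finset.mem_univ _), Finset.card_univ, Fintype.card_fun, Fintype.card_bool, Fintype.card_fin]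
  funext i
  simp only [Pi.add_apply, Pi.sub_apply, Pi.smul_apply]
  simp only [smul_eq_mul, nsmul_eq_mul, Nat.cast_pow, Nat.cast_ofNat]
  ring

/-- **THEOREM (PATH)**: the block map of the host with `e₀` replaced by a path with `n` internal vertices (exits
`inl ∘ u`, anchor `inl a₁`) is the block map of the host plus `2ⁿ − 1` times the block map of the host with `e₀`
turned into a loop. -/
theorem blockMap_path (w : ι → Vec6) :
    blockMap (pathHost Z₁ e₀ n) (fun k => Sum.inl (u k)) (Sum.inl a₁) w =
      blockMap Z₁ u a₁ w + ((2 : ℝ) ^ n - 1) • blockMap (loopify Z₁ e₀) u a₁ w := by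
  rw [blockMap_eq_sum_colTerm, blockMap_eq_sum_colTerm, blockMap_eq_sum_colTerm, Finset.smul_sum,
    ← Finset.sum_add_distrib,
    ← Fintype.sum_equiv (Equiv.sumArrowEquivProdArrow E₁ (Fin n) Bool).symm
      (fun p => colTerm (pathHost Z₁ e₀ n) (fun k => Sum.inl (u k)) (Sum.inl a₁)
        ((Equiv.sumArrowEquivProdArrow E₁ (Fin n) Bool).symm p) w) _ (fun _ => rfl),
    Fintype.sum_prod_type]
  exact Finset.sum_congr rfl fun ω _ => sum_colTerm_path_elim Z₁ e₀ n u a₁ ω w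

/-- **THEOREM (PATH), deletion form**: `Θ_{Z₁ with e₀ replaced by a path with n internal vertices} =
Θ_{Z₁} + (2^{n+1} − 2)·Θ_{Z₁ − e₀}`. -/
theorem blockMap_path_del (w : ι → Vec6) :
    blockMap (pathHost Z₁ e₀ n) (fun k => Sum.inl (u k)) (Sum.inl a₁) w =
      blockMap Z₁ u a₁ w + ((2 : ℝ) ^ (n + 1) - 2) • blockMap (del Z₁ e₀) u a₁ w := by
  rw [blockMap_path, blockMap_loopify, smul_smul, show ((2 : ℝ) ^ n - 1) * 2 = 2 ^ (n + 1) - 2 by ring]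

/-- `2ⁿ − 1 ≥ 0`. -/
theorem two_pow_sub_one_nonneg : (0 : ℝ) ≤ 2 ^ n - 1 := by
  have h : (1 : ℝ) ≤ 2 ^ n := one_le_pow₀ (by norm_num)
  linarith

/-- **The cone conjecture for block maps is closed under replacing an edge by a path**: if the block maps of `Z₁`
and of the loopified host send the family `w` into the cone, so does the block map of the path host. -/
theorem inCone_blockMap_path (w : ι → Vec6) (h₁ : InCone (blockMap Z₁ u a₁ w))
    (h₂ : InCone (blockMap (loopify Z₁ e₀) u a₁ w)) :
    InCone (blockMap (pathHost Z₁ e₀ n) (fun k => Sum.inl (u k)) (Sum.inl a₁) w) := by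
  rw [blockMap_path]
  exact h₁.add (h₂.smul _ (two_pow_sub_one_nonneg n))

/-- **The cone conjecture for block maps is closed under replacing an edge by a path**, deletion form. -/
theorem inCone_blockMap_path_del (w : ι → Vec6) (h₁ : InCone (blockMap Z₁ u a₁ w))
    (h₂ : InCone (blockMap (del Z₁ e₀) u a₁ w)) :
    InCone (blockMap (pathHost Z₁ e₀ n) (fun k => Sum.inl (u k)) (Sum.inl a₁) w) := by
  rw [blockMap_path_del]
  refine h₁.add (h₂.smul _ ?_)
  have h : (1 : ℝ) ≤ 2 ^ n := one_le_pow₀ (by norm_num)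
  rw [pow_succ]
  linarith

end Main

end MultiExit

end ZoneZ

end PercRepro
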